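import Mathlib
import HarnessLib
import Literature.Probability.Percolation.Percolation
import Summits.CriticalPhenomena.PercolationContinuityZ3.Theorems.PercNearOneGluingNoHeavyLowerTailAntipodalInterfaceGluing

/-!
# The fibrewise SPLIT inequality (T2) on graphs with a cut vertex between the two terminal pairs

Helper file for crux `stmt-CriticalPhenomena-4575` (`NoHeavyLowerTail`, route `PercNearOneGluingNoHeavy`),
new-inequality factory seat `prim-ineq-gen-1` (gen 9).  Everything here is PROVED; no route definition is touched.
Memos: `run/shared/lean/prim/prim-ineq-gen-1/FINDING-14-core-lemma-refuted.md` §6 and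
`FINDING-15-junctions-and-two-sided-nogos.md` §2.

**What this file adds.**  `…AntipodalInterfaceGluing.lean` proves the ABSTRACT set-system form of the one
two-sided mechanism known to be rigorous for the conjectured fibrewise (antipodal) SPLIT inequality T2
(`Σ_Y 1_𝒩(Y) α(Y) γ(Y) ≤ 0` for the 2-colouring `(Y, Yᶜ)` of the free edges, see that file): an
"excluding interface" with up-sets on both sides.  Here we prove the GRAPH-LEVEL statement it was designed
for, in the vocabulary of `Literature.Probability.Percolation` (`openGraph ω = SimpleGraph.fromEdgeSet ω`):

* `reach_decomp` / `reach_iff_side` / `reach_cross_iff` — if every open edge lies inside `U₁` or inside `U₂`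
  and `U₁ ∩ U₂ ⊆ {w}` (a cut vertex), then reachability between two vertices of `U₁` is reachability inside
  the `U₁`-edges, and a vertex of `U₁` reaches a vertex of `U₂ ∖ U₁` iff it reaches `w` on side 1 and `w`
  reaches the target on side 2 (induction on `Relation.ReflTransGen`, via
  `SimpleGraph.reachable_fromEdgeSet_eq_reflTransGen_toRel`);
* `cutVertex_antipodal_split_nonpos` — **T2 across a cut vertex**: for terminal pairs `{a,v} ⊆ U₁`,
  `{b,c} ⊆ U₂ ∖ U₁`, fixed open edges `F₁, F₂` and free edges `e₁ : ι₁ → Sym2 V`, `e₂ : ι₂ → Sym2 V` on the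
  two sides (labels need not be injective, so multigraphs and every interval `[F, F ∪ W]` of every minor are
  covered), the antipodal correlation sum
  `Σ_{X ⊆ ι₁} Σ_{Z ⊆ ι₂} 1_𝒩 · ([a ~_red v] − [a ~_blue v]) · ([b ~_red c] − [b ~_blue c]) ≤ 0`,
  where red = `F₁ ∪ e₁(X) ∪ F₂ ∪ e₂(Z)`, blue = `F₁ ∪ e₁(Xᶜ) ∪ F₂ ∪ e₂(Zᶜ)` and `𝒩` = "no red and no blue path
  from `{a,v}` to `{b,c}`".  (Equivalently `#{red av|bc, blue a|b|c|v} ≤ #{red av|b|c, blue a|bc|v}` on such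
  graphs — FINDING-13 FACT 0; that bookkeeping identity is not repeated here.)

This covers, as theorems, the named obstruction graphs of the injection programme that turned out to be
cut-vertex graphs (FINDING-15 §2: W1, W2, the gen-7 obstruction, the dumbbell, core-lemma instance (i)) and the
383 'cut-vertex gadgets' of kit j094231; the genuinely 2-connected interface has no such certificate
(FINDING-15 §2, 0/1,828).  (Found and proved by this seat, 2026-08-20.)
-/

namespace Summit.CriticalPhenomena.PercolationContinuityZ3.Theorems

namespace AntipodalCutVertex

open Finset Literature.Probability.Percolation AntipodalInterfaceGluing

variable {V : Type*}

/-- Reachability in the open graph of `ω` is the reflexive–transitive closure of "`s(x,y) ∈ ω`". [this work] -/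
theorem reachable_iff (ω : Set (Sym2 V)) (x y : V) :
    (openGraph ω).Reachable x y ↔ Relation.ReflTransGen (Sym2.ToRel ω) x y := by
  show (SimpleGraph.fromEdgeSet ω).Reachable x y ↔ _
  rw [SimpleGraph.reachable_fromEdgeSet_eq_reflTransGen_toRel]

/-- An open edge joins its endpoints. [this work] -/
theorem reachable_of_mem {ω : Set (Sym2 V)} {x y : V} (h : s(x, y) ∈ ω) : (openGraph ω).Reachable x y :=
  (reachable_iff ω x y).mpr (Relation.ReflTransGen.single h)

section CutVertex

variable {U₁ U₂ : Set V} {w : V} {ω₁ ω₂ : Set (Sym2 V)}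

/-- **Cut-vertex decomposition of reachability.**  If every edge of `ω₁` lies inside `U₁`, every edge of
`ω₂` inside `U₂`, and `U₁ ∩ U₂ ⊆ {w}`, then a vertex reachable in `ω₁ ∪ ω₂` from `s ∈ U₁` is either a
`U₁`-vertex reachable inside `ω₁`, or a `U₂`-vertex reachable from `w` inside `ω₂` with `w` reachable from
`s` inside `ω₁`. [this work] -/
theorem reach_decomp (hU : ∀ x, x ∈ U₁ → x ∈ U₂ → x = w)
    (h₁ : ∀ e ∈ ω₁, ∀ x ∈ e, x ∈ U₁) (h₂ : ∀ e ∈ ω₂, ∀ x ∈ e, x ∈ U₂)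
    {s : V} (hs : s ∈ U₁) {x : V} (hx : (openGraph (ω₁ ∪ ω₂)).Reachable s x) :
    (x ∈ U₁ ∧ (openGraph ω₁).Reachable s x) ∨
      (x ∈ U₂ ∧ (openGraph ω₁).Reachable s w ∧ (openGraph ω₂).Reachable w x) := by
  rw [reachable_iff] at hx
  induction hx with
  | refl => exact Or.inl ⟨hs, SimpleGraph.Reachable.refl s⟩
  | @tail y z _ hyz ih =>
    rcases hyz with hyz | hyz
    · -- a side-1 edge: both endpoints in U₁
      have hy : y ∈ U₁ := h₁ _ hyz y (Sym2.mem_mk_left y z)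
      have hz : z ∈ U₁ := h₁ _ hyz z (Sym2.mem_mk_right y z)
      rcases ih with ⟨_, r⟩ | ⟨hy2, rw_, _⟩
      · exact Or.inl ⟨hz, r.trans (reachable_of_mem hyz)⟩
      · have hyw : y = w := hU y hy hy2
        subst hyw
        exact Or.inl ⟨hz, rw_.trans (reachable_of_mem hyz)⟩
    · -- a side-2 edge: both endpoints in U₂
      have hy : y ∈ U₂ := h₂ _ hyz y (Sym2.mem_mk_left y z)
      have hz : z ∈ U₂ := h₂ _ hyz z (Sym2.mem_mk_right y z)
      rcases ih with ⟨hy1, r⟩ | ⟨_, rw_, r2⟩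
      · have hyw : y = w := hU y hy1 hy
        subst hyw
        exact Or.inr ⟨hz, r, reachable_of_mem hyz⟩
      · exact Or.inr ⟨hz, rw_, r2.trans (reachable_of_mem hyz)⟩

/-- Between two vertices of `U₁`, reachability in `ω₁ ∪ ω₂` is reachability inside `ω₁`. [this work] -/
theorem reach_iff_side (hU : ∀ x, x ∈ U₁ → x ∈ U₂ → x = w)
    (h₁ : ∀ e ∈ ω₁, ∀ x ∈ e, x ∈ U₁) (h₂ : ∀ e ∈ ω₂, ∀ x ∈ e, x ∈ U₂)
    {s x : V} (hs : s ∈ U₁) (hx : x ∈ U₁) :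
    (openGraph (ω₁ ∪ ω₂)).Reachable s x ↔ (openGraph ω₁).Reachable s x := by
  constructor
  · intro h
    rcases reach_decomp hU h₁ h₂ hs h with ⟨_, r⟩ | ⟨hx2, r, _⟩
    · exact r
    · have hxw : x = w := hU x hx hx2
      subst hxw
      exact r
  · exact fun r => r.mono (SimpleGraph.fromEdgeSet_mono Set.subset_union_left)

/-- From `s ∈ U₁` to `t ∈ U₂ ∖ U₁`: reachable in `ω₁ ∪ ω₂` iff `s` reaches `w` inside `ω₁` and `w` reaches
`t` inside `ω₂`. [this work] -/
theorem reach_cross_iff (hU : ∀ x, x ∈ U₁ → x ∈ U₂ → x = w)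
    (h₁ : ∀ e ∈ ω₁, ∀ x ∈ e, x ∈ U₁) (h₂ : ∀ e ∈ ω₂, ∀ x ∈ e, x ∈ U₂)
    {s t : V} (hs : s ∈ U₁) (ht : t ∉ U₁) :
    (openGraph (ω₁ ∪ ω₂)).Reachable s t ↔
      (openGraph ω₁).Reachable s w ∧ (openGraph ω₂).Reachable w t := by
  constructor
  · intro h
    rcases reach_decomp hU h₁ h₂ hs h with ⟨ht1, _⟩ | ⟨_, r1, r2⟩
    · exact absurd ht1 ht
    · exact ⟨r1, r2⟩
  · rintro ⟨r1, r2⟩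
    exact (r1.mono (SimpleGraph.fromEdgeSet_mono Set.subset_union_left)).trans
      (r2.mono (SimpleGraph.fromEdgeSet_mono Set.subset_union_right))

end CutVertex

section Split

variable {ι₁ ι₂ : Type*} [DecidableEq ι₁] [Fintype ι₁] [DecidableEq ι₂] [Fintype ι₂]

/-- One side of a glued colouring is the fixed open edges `F` plus the free edges labelled by `X`,
`F ∪ e '' X`; it is monotone in `X`. [this work] -/
theorem side_mono (F : Set (Sym2 V)) {ι : Type*} (e : ι → Sym2 V) {X X' : Finset ι} (h : X ⊆ X') :
    F ∪ e '' (↑X : Set ι) ⊆ F ∪ e '' (↑X' : Set ι) :=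
  Set.union_subset_union_right F (Set.image_mono (Finset.coe_subset.mpr h))

/-- All edges of a side `F ∪ e '' X` lie inside its vertex set. [this work] -/
theorem side_subset {U : Set V} {F : Set (Sym2 V)} {ι : Type*} {e : ι → Sym2 V}
    (hF : ∀ s ∈ F, ∀ x ∈ s, x ∈ U) (he : ∀ i, ∀ x ∈ e i, x ∈ U) (X : Finset ι) :
    ∀ s ∈ F ∪ e '' (↑X : Set ι), ∀ x ∈ s, x ∈ U := by
  intro s hs x hx
  rcases hs with hs | ⟨i, _, rfl⟩
  · exact hF s hs x hx
  · exact he i x hx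

open scoped Classical in
/-- **The fibrewise SPLIT inequality (T2) across a cut vertex, graph form.**  Let the open-edge universe be
glued from two sides along a single vertex `w` (`U₁ ∩ U₂ ⊆ {w}`; side-1 edges `F₁`, `e₁ i` inside `U₁`, side-2
edges inside `U₂`), with the terminal pair `{a, v} ⊆ U₁` (`a = w` or `v = w` is allowed) and the pair
`{b, c} ⊆ U₂ ∖ U₁`.  Colour the
free edges: red configuration `F₁ ∪ e₁(X) ∪ F₂ ∪ e₂(Z)`, blue configuration `F₁ ∪ e₁(Xᶜ) ∪ F₂ ∪ e₂(Zᶜ)`.  Then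
`Σ_X Σ_Z 1[no monochromatic {a,v}–{b,c} path] · ([a~v red] − [a~v blue]) · ([b~c red] − [b~c blue]) ≤ 0`:
under two-sided separation the colour preferences of the two pairs are negatively correlated.  Proof: the
cut-vertex decomposition turns the sum into the excluding-interface sum of
`AntipodalInterfaceGluing.sum_excl_mul_pref_mul_pref_nonpos` with the up-sets `{a ~ v}`, `{w ~ {a,v}}` on
side 1 and `{b ~ c}`, `{w ~ {b,c}}` on side 2. [new] -/
theorem cutVertex_antipodal_split_nonpos {U₁ U₂ : Set V} {w a v b c : V}
    (hU : ∀ x, x ∈ U₁ → x ∈ U₂ → x = w)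
    (ha : a ∈ U₁) (hv : v ∈ U₁)
    (hb : b ∈ U₂) (hb' : b ∉ U₁) (hc : c ∈ U₂) (hc' : c ∉ U₁)
    {F₁ F₂ : Set (Sym2 V)} (hF₁ : ∀ s ∈ F₁, ∀ x ∈ s, x ∈ U₁) (hF₂ : ∀ s ∈ F₂, ∀ x ∈ s, x ∈ U₂)
    {e₁ : ι₁ → Sym2 V} {e₂ : ι₂ → Sym2 V} (he₁ : ∀ i, ∀ x ∈ e₁ i, x ∈ U₁) (he₂ : ∀ i, ∀ x ∈ e₂ i, x ∈ U₂) :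
    ∑ X : Finset ι₁, ∑ Z : Finset ι₂,
      (if (¬ ((openGraph ((F₁ ∪ e₁ '' ↑X) ∪ (F₂ ∪ e₂ '' ↑Z))).Reachable a b ∨
              (openGraph ((F₁ ∪ e₁ '' ↑X) ∪ (F₂ ∪ e₂ '' ↑Z))).Reachable a c ∨
              (openGraph ((F₁ ∪ e₁ '' ↑X) ∪ (F₂ ∪ e₂ '' ↑Z))).Reachable v b ∨
              (openGraph ((F₁ ∪ e₁ '' ↑X) ∪ (F₂ ∪ e₂ '' ↑Z))).Reachable v c)) ∧
           (¬ ((openGraph ((F₁ ∪ e₁ '' ↑Xᶜ) ∪ (F₂ ∪ e₂ '' ↑Zᶜ))).Reachable a b ∨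
              (openGraph ((F₁ ∪ e₁ '' ↑Xᶜ) ∪ (F₂ ∪ e₂ '' ↑Zᶜ))).Reachable a c ∨
              (openGraph ((F₁ ∪ e₁ '' ↑Xᶜ) ∪ (F₂ ∪ e₂ '' ↑Zᶜ))).Reachable v b ∨
              (openGraph ((F₁ ∪ e₁ '' ↑Xᶜ) ∪ (F₂ ∪ e₂ '' ↑Zᶜ))).Reachable v c))
        then (1 : ℤ) else 0) *
      ((if (openGraph ((F₁ ∪ e₁ '' ↑X) ∪ (F₂ ∪ e₂ '' ↑Z))).Reachable a v then (1 : ℤ) else 0) -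
        (if (openGraph ((F₁ ∪ e₁ '' ↑Xᶜ) ∪ (F₂ ∪ e₂ '' ↑Zᶜ))).Reachable a v then (1 : ℤ) else 0)) *
      ((if (openGraph ((F₁ ∪ e₁ '' ↑X) ∪ (F₂ ∪ e₂ '' ↑Z))).Reachable b c then (1 : ℤ) else 0) -
        (if (openGraph ((F₁ ∪ e₁ '' ↑Xᶜ) ∪ (F₂ ∪ e₂ '' ↑Zᶜ))).Reachable b c then (1 : ℤ) else 0)) ≤ 0 := by
  -- the four up-sets
  set 𝒜 : Finset (Finset ι₁) := Finset.univ.filter (fun X => (openGraph ((F₁ ∪ e₁ '' ↑X))).Reachable a v)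
    with h𝒜def
  set ℛ : Finset (Finset ι₁) := Finset.univ.filter
      (fun X => (openGraph ((F₁ ∪ e₁ '' ↑X))).Reachable a w ∨ (openGraph ((F₁ ∪ e₁ '' ↑X))).Reachable v w)
    with hℛdef
  set 𝒢 : Finset (Finset ι₂) := Finset.univ.filter (fun Z => (openGraph ((F₂ ∪ e₂ '' ↑Z))).Reachable b c)
    with h𝒢def
  set 𝒯 : Finset (Finset ι₂) := Finset.univ.filter
      (fun Z => (openGraph ((F₂ ∪ e₂ '' ↑Z))).Reachable w b ∨ (openGraph ((F₂ ∪ e₂ '' ↑Z))).Reachable w c)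
    with h𝒯def
  have m𝒜 : ∀ X, X ∈ 𝒜 ↔ (openGraph ((F₁ ∪ e₁ '' ↑X))).Reachable a v := fun X => by
    simp [h𝒜def]
  have mℛ : ∀ X, X ∈ ℛ ↔
      ((openGraph ((F₁ ∪ e₁ '' ↑X))).Reachable a w ∨ (openGraph ((F₁ ∪ e₁ '' ↑X))).Reachable v w) := fun X => by
    simp [hℛdef]
  have m𝒢 : ∀ Z, Z ∈ 𝒢 ↔ (openGraph ((F₂ ∪ e₂ '' ↑Z))).Reachable b c := fun Z => by
    simp [h𝒢def]
  have m𝒯 : ∀ Z, Z ∈ 𝒯 ↔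
      ((openGraph ((F₂ ∪ e₂ '' ↑Z))).Reachable w b ∨ (openGraph ((F₂ ∪ e₂ '' ↑Z))).Reachable w c) := fun Z => by
    simp [h𝒯def]
  have h𝒜 : IsUpperSet (𝒜 : Set (Finset ι₁)) := by
    intro X X' hXX' hX
    rw [Finset.mem_coe, m𝒜] at hX ⊢
    exact hX.mono (SimpleGraph.fromEdgeSet_mono (side_mono F₁ e₁ hXX'))
  have hℛ : IsUpperSet (ℛ : Set (Finset ι₁)) := by
    intro X X' hXX' hX
    rw [Finset.mem_coe, mℛ] at hX ⊢
    exact hX.imp (fun r => r.mono (SimpleGraph.fromEdgeSet_mono (side_mono F₁ e₁ hXX')))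
      (fun r => r.mono (SimpleGraph.fromEdgeSet_mono (side_mono F₁ e₁ hXX')))
  have h𝒢 : IsUpperSet (𝒢 : Set (Finset ι₂)) := by
    intro Z Z' hZZ' hZ
    rw [Finset.mem_coe, m𝒢] at hZ ⊢
    exact hZ.mono (SimpleGraph.fromEdgeSet_mono (side_mono F₂ e₂ hZZ'))
  have h𝒯 : IsUpperSet (𝒯 : Set (Finset ι₂)) := by
    intro Z Z' hZZ' hZ
    rw [Finset.mem_coe, m𝒯] at hZ ⊢
    exact hZ.imp (fun r => r.mono (SimpleGraph.fromEdgeSet_mono (side_mono F₂ e₂ hZZ')))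
      (fun r => r.mono (SimpleGraph.fromEdgeSet_mono (side_mono F₂ e₂ hZZ')))
  -- the cut-vertex translations, for an arbitrary pair of colour classes
  have hav : ∀ (X : Finset ι₁) (Z : Finset ι₂),
      (openGraph ((F₁ ∪ e₁ '' ↑X) ∪ (F₂ ∪ e₂ '' ↑Z))).Reachable a v ↔ X ∈ 𝒜 := fun X Z => by
    rw [m𝒜]
    exact reach_iff_side hU (side_subset hF₁ he₁ X) (side_subset hF₂ he₂ Z) ha hv
  have hbc : ∀ (X : Finset ι₁) (Z : Finset ι₂),
      (openGraph ((F₁ ∪ e₁ '' ↑X) ∪ (F₂ ∪ e₂ '' ↑Z))).Reachable b c ↔ Z ∈ 𝒢 := fun X Z => by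
    rw [m𝒢, Set.union_comm]
    exact reach_iff_side (U₁ := U₂) (U₂ := U₁) (fun x h2 h1 => hU x h1 h2)
      (side_subset hF₂ he₂ Z) (side_subset hF₁ he₁ X) hb hc
  have hcr : ∀ (X : Finset ι₁) (Z : Finset ι₂),
      ((openGraph ((F₁ ∪ e₁ '' ↑X) ∪ (F₂ ∪ e₂ '' ↑Z))).Reachable a b ∨
        (openGraph ((F₁ ∪ e₁ '' ↑X) ∪ (F₂ ∪ e₂ '' ↑Z))).Reachable a c ∨
        (openGraph ((F₁ ∪ e₁ '' ↑X) ∪ (F₂ ∪ e₂ '' ↑Z))).Reachable v b ∨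
        (openGraph ((F₁ ∪ e₁ '' ↑X) ∪ (F₂ ∪ e₂ '' ↑Z))).Reachable v c) ↔ (X ∈ ℛ ∧ Z ∈ 𝒯) := fun X Z => by
    rw [mℛ, m𝒯,
      reach_cross_iff hU (side_subset hF₁ he₁ X) (side_subset hF₂ he₂ Z) ha hb',
      reach_cross_iff hU (side_subset hF₁ he₁ X) (side_subset hF₂ he₂ Z) ha hc',
      reach_cross_iff hU (side_subset hF₁ he₁ X) (side_subset hF₂ he₂ Z) hv hb',
      reach_cross_iff hU (side_subset hF₁ he₁ X) (side_subset hF₂ he₂ Z) hv hc']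
    tauto
  have h := sum_excl_mul_pref_mul_pref_nonpos h𝒜 hℛ h𝒢 h𝒯
  refine Eq.trans_le ?_ h
  refine Finset.sum_congr rfl fun X _ => Finset.sum_congr rfl fun Z _ => ?_
  have e1 := if_congr (α := ℤ) (x := 1) (y := 0)
    (and_congr (not_congr (hcr X Z)) (not_congr (hcr Xᶜ Zᶜ))) rfl rfl
  have e2 := if_congr (α := ℤ) (x := 1) (y := 0) (hav X Z) rfl rfl
  have e3 := if_congr (α := ℤ) (x := 1) (y := 0) (hav Xᶜ Zᶜ) rfl rfl
  have e4 := if_congr (α := ℤ) (x := 1) (y := 0) (hbc X Z) rfl rfl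
  have e5 := if_congr (α := ℤ) (x := 1) (y := 0) (hbc Xᶜ Zᶜ) rfl rfl
  rw [e1, e2, e3, e4, e5]

end Split

end AntipodalCutVertex

end Summit.CriticalPhenomena.PercolationContinuityZ3.Theorems
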